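import Mathlib
import Summits.KontsevichZagierPeriods.Zeta5Search.BrickHatWeight
import Summits.KontsevichZagierPeriods.Zeta5Search.BrickResidueLawCirc

/-!
# BrickHatReduction — zi-p2's THEOREM 9 LEMMA 9.4 (REDUCTION): the `p − 1` off-digit cells of a block `j` of the row
`np` contribute `p^A·Ŵ(j)·r̂_j^{(s)}(n) + O(p^{A+L+1})`, i.e. `p^{A+1}·g₀(j)·r̃_j^{(s)}(n−1) + O(p^{A+L+1})`, for the cells
`s ≥ 1` and for the harmonic cell (cell zeta5-irr)

HONEST FRAMING: systematic search; no irrationality claim unless certified. INSTRUMENT lemmas of the ζ(5)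
census cell zeta5-irr (HOME `run/shared/lean/pub/zeta5-irr/`; memo `zi-p2/probes/B8/thm9/THEOREM9.md` (sealed
eae326393abac726) §2 (iii) «REDUCTION (no level hypothesis). For every s ∈ {0} ∪ [1,A] and every block 0 ≤ j ≤ n−1:
Σ_{i=1}^{p−1} r_{jp+i}^{(s)}(np) = p^A·Ŵ(j)·r̂_j^{(s)}(n) + E_j^{(s)}, v(E_j^{(s)}) ≥ A + L + 1» and LEMMA 9.4 «(4.1) …
INTEGRALITY: r̂_j^{(s′)}(n) ∈ ℤ_(p) … (2.2): if n ≠ p^L then … r̂_j^{(s)}(n) = Σ_m P_m(j)p^{Lm}r̃_j^{(s+m)}(M)»). In the tree's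
NOMINAL-LEVEL vocabulary (`m = n − 1 < p^{L+1}`, normalisation `p^{L(A−s)}` on the row `m`, `p^{(L+1)(A−s)}` on `np`) the
special branch `n = p^L` of (2.2) disappears. Nothing here is about ζ(5); no irrationality content; filing moves no rung.
Filed by the engine seat zi-eng (g10); inputs `BrickHatStrip.laurentSeries_rescale_eq_hat` (THEOREM 9 (i)),
`BrickHatMultiplier` (`a = hatMult`, `v(a) = exp(−A)·v(n)^{A−2B}`), `BrickHatWeight` (`Ŵ ≡ 0 (mod p)`, `g₀`),
`BrickResidueLawMain.level_*` (level integrality, harmonic blocks).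

## The statements (`p` odd prime, `A` even, `2B ≤ A`, `n = m + 1`, `m < p^{L+1}`, block `j ≤ m`, digits `i = t + 1 ≤ p − 1`)

* GENERIC two-scale mechanism, for any identity `rescale_p F_K^{(N)} = C a·F̃_J^{(M)}·E·U` with `E ∈ ℤ_(p)[X]`, `U(0) = 1`,
  `[T^g]U ∈ p^gℤ_(p)`, `J ≤ M < p^{L+1}`: `hatLaurent A B E M J d := [T^d](F̃_J·E)`, `level_hatLaurent_integral`,
  `hatLaurent_main_sub_le` (`p^{Ld}[T^d](F̃_J E) ≡ E(0)·p^{Ld}[T^d]F̃_J (mod p^L)`), **`twoScale_depth`**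
  (`v(p^{(L+1)d}[T^d]F_K − a·p^{Ld}[T^d](F̃_J E)) ≤ v(a)·exp(−(L+1))`) and **`twoScale_zero`** (harmonic cell,
  `hatLaurentZero`) — reusable for THEOREM 10's class kernels (`E = Ê·Q^{cl}`).
* HAT CELLS: `hat_cell_depth`, `hat_cell_zero` (`a = hatMult`, `v ≤ exp(−(A+L+1))`); blocks: **`hat_block_main`**
  (`v(Σ_{i=1}^{p−1} p^{(L+1)d}[T^d]F_{jp+i}^{(np)} − p^{A+1}·g₀(j)·p^{Ld}[T^d]F̃_j^{(m)}) ≤ exp(−(A+L+1))`) and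
  **`hat_block_main_zero`** (harmonic cell).
-/

namespace Summit.KontsevichZagierPeriods.Zeta5Search.BrickHatReduction

open Finset Nat Polynomial WithZero
open Summit.KontsevichZagierPeriods.Zeta5Search.BrickLaurent (laurentSeries laurent cell)
open Summit.KontsevichZagierPeriods.Zeta5Search.BrickPartialFractions (cellZero)
open Summit.KontsevichZagierPeriods.Zeta5Search.ScaledSeries (IsSlopeInt)
open Summit.KontsevichZagierPeriods.Zeta5Search.BrickHarmonicBlocks (hsum)
open Summit.KontsevichZagierPeriods.Zeta5Search.BrickDigitStepDZero (cellZero_eq)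
open Summit.KontsevichZagierPeriods.Zeta5Search.BrickResidueLawMain (cong_mul_le level_hsum_sub_le
  level_laurent_integral level_hsum_integral)
open Summit.KontsevichZagierPeriods.Zeta5Search.BrickHatStrip (hatPoly laurentSeries_rescale_eq_hat)
open Summit.KontsevichZagierPeriods.Zeta5Search.BrickHatMultiplier (hatMult hatLam hatMult_eq eq_hatMult
  padicValuation_hatLam)
open Summit.KontsevichZagierPeriods.Zeta5Search.BrickHatWeight (hatW hatG hatW_le padicValuation_hatPoly_coeff_le
  padicValuation_hatPoly_eval_zero_le)
open Literature.NumberTheory.LFunctions (padicValuation_natCast_le_one)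

noncomputable section

variable {p : ℕ} [Fact p.Prime]

/-! ## The generic two-scale mechanism -/

/-- `[T^d](F̃_J^{(M)}·E)` — the Laurent coefficient of the symmetric kernel at `−J` twisted by a polynomial `E`
(for `E = Ê_J` and `M = n − 1`: `n^{A−2B}` times this is zi-p2's `ĉ_{J,A−d}(n)`, the hat-kernel coefficient). -/
def hatLaurent (A B : ℕ) (E : ℚ[X]) (M J d : ℕ) : ℚ :=
  PowerSeries.coeff d (laurentSeries A B 0 M J * ((E : ℚ[X]) : PowerSeries ℚ))

/-- `p^{LA}·[harmonic cell]` of the twisted kernel at nominal level `L`: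
`−Σ_{s=1}^{A} (p^{L(A−s)}[T^{A−s}](F̃_J E))·(p^{Ls}H_J^{(s)})`. -/
def hatLaurentZero (A B : ℕ) (E : ℚ[X]) (p L M J : ℕ) : ℚ :=
  -∑ s ∈ Icc 1 A, ((p : ℚ) ^ (L * (A - s)) * hatLaurent A B E M J (A - s)) * ((p : ℚ) ^ (L * s) * hsum s J)

omit [Fact p.Prime] in
/-- `[T^d](F̃_J·E) = Σ_{k+h=d} [T^k]F̃_J·[X^h]E`. -/
theorem hatLaurent_eq_sum (A B : ℕ) (E : ℚ[X]) (M J d : ℕ) :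
    hatLaurent A B E M J d = ∑ x ∈ antidiagonal d, laurent A B 0 M J x.1 * E.coeff x.2 := by
  unfold hatLaurent laurent
  rw [PowerSeries.coeff_mul]
  simp only [Polynomial.coeff_coe]

section generic

variable (hp2 : p ≠ 2) {A B : ℕ} (hAB : 2 * B ≤ A) {M J L : ℕ} (hM : M < p ^ (L + 1)) (hJ : J ≤ M)
  {E : ℚ[X]} (hE : ∀ h, Rat.padicValuation p (E.coeff h) ≤ 1)
include hp2 hAB hM hJ hE

/-- Level integrality: `v(p^{Ld}·[T^d](F̃_J E)) ≤ 1` (`J ≤ M < p^{L+1}`, `E ∈ ℤ_(p)[X]`). -/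
theorem level_hatLaurent_integral (d : ℕ) :
    Rat.padicValuation p ((p : ℚ) ^ (L * d) * hatLaurent A B E M J d) ≤ 1 := by
  rw [hatLaurent_eq_sum, Finset.mul_sum]
  refine Valuation.map_sum_le _ fun x hx => ?_
  have hx' := mem_antidiagonal.1 hx
  rw [show (p : ℚ) ^ (L * d) * (laurent A B 0 M J x.1 * E.coeff x.2) =
    ((p : ℚ) ^ (L * x.1) * laurent A B 0 M J x.1) * ((p : ℚ) ^ (L * x.2) * E.coeff x.2) by
      rw [← hx', mul_add, pow_add]; ring, map_mul]
  refine mul_le_one' (level_laurent_integral hp2 hAB hM hJ x.1) ?_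
  rw [map_mul, map_pow, Rat.padicValuation_self, ← exp_nsmul]
  refine mul_le_one' ?_ (hE x.2)
  rw [← exp_zero, exp_le_exp, nsmul_eq_mul]; push_cast; nlinarith

/-- The twisted coefficient against the plain one: `v(p^{Ld}[T^d](F̃_J E) − E(0)·p^{Ld}[T^d]F̃_J) ≤ exp(−L)` (the terms
with a positive power of `X` from `E` carry `p^{Lh}`, `h ≥ 1`). -/
theorem hatLaurent_main_sub_le (d : ℕ) :
    Rat.padicValuation p ((p : ℚ) ^ (L * d) * hatLaurent A B E M J d -
      E.eval 0 * ((p : ℚ) ^ (L * d) * laurent A B 0 M J d)) ≤ exp (-(L : ℤ)) := by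
  rw [hatLaurent_eq_sum, Finset.Nat.sum_antidiagonal_eq_sum_range_succ (fun k h => laurent A B 0 M J k * E.coeff h) d,
    Finset.sum_range_succ, Nat.sub_self, Polynomial.coeff_zero_eq_eval_zero, mul_add, add_sub_assoc,
    show (p : ℚ) ^ (L * d) * (laurent A B 0 M J d * E.eval 0) - E.eval 0 * ((p : ℚ) ^ (L * d) * laurent A B 0 M J d) = 0
      by ring, add_zero, Finset.mul_sum]
  refine Valuation.map_sum_le _ fun k hk => ?_
  have hk' := mem_range.1 hk
  rw [show (p : ℚ) ^ (L * d) * (laurent A B 0 M J k * E.coeff (d - k)) =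
    ((p : ℚ) ^ (L * k) * laurent A B 0 M J k) * ((p : ℚ) ^ (L * (d - k)) * E.coeff (d - k)) by
      rw [show L * d = L * k + L * (d - k) by rw [← mul_add]; congr 1; omega, pow_add]; ring, map_mul]
  refine (mul_le_mul' (level_laurent_integral hp2 hAB hM hJ k) ?_).trans (by rw [one_mul])
  rw [map_mul, map_pow, Rat.padicValuation_self, ← exp_nsmul]
  calc _ ≤ exp (-(L : ℤ)) * 1 := mul_le_mul' (by
          rw [exp_le_exp, nsmul_eq_mul]; push_cast
          nlinarith [Int.natCast_nonneg L, show (1 : ℤ) ≤ ((d - k : ℕ) : ℤ) by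
            exact_mod_cast (show 1 ≤ d - k by omega)]) (hE _)
    _ = _ := mul_one _

/-- The twisted harmonic cell against the plain one:
`v(hatLaurentZero − E(0)·p^{LA}·cell̃^{(0)}_J(M)) ≤ exp(−L)`. -/
theorem hatLaurentZero_main_sub_le :
    Rat.padicValuation p (hatLaurentZero A B E p L M J - E.eval 0 * ((p : ℚ) ^ (L * A) * cellZero A B 0 M J)) ≤
      exp (-(L : ℤ)) := by
  have hJlt : J < p ^ (L + 1) := lt_of_le_of_lt hJ hM
  have hy : E.eval 0 * ((p : ℚ) ^ (L * A) * cellZero A B 0 M J) =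
      -∑ s ∈ Icc 1 A, (E.eval 0 * ((p : ℚ) ^ (L * (A - s)) * laurent A B 0 M J (A - s))) *
        ((p : ℚ) ^ (L * s) * hsum s J) := by
    rw [cellZero_eq, mul_neg, mul_neg, Finset.mul_sum, Finset.mul_sum]
    congr 1
    refine Finset.sum_congr rfl fun s hs => ?_
    have hs' := mem_Icc.1 hs
    rw [show (p : ℚ) ^ (L * A) = (p : ℚ) ^ (L * (A - s)) * (p : ℚ) ^ (L * s) by
      rw [← pow_add, ← mul_add, Nat.sub_add_cancel hs'.2], show cell A B 0 M J s = laurent A B 0 M J (A - s) from rfl]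
    ring
  rw [hatLaurentZero, hy, neg_sub_neg, ← Finset.sum_sub_distrib]
  refine Valuation.map_sum_le _ fun s hs => ?_
  rw [← sub_mul, map_mul, Valuation.map_sub_swap]
  calc _ ≤ exp (-(L : ℤ)) * 1 := mul_le_mul' (hatLaurent_main_sub_le hp2 hAB hM hJ hE _) (level_hsum_integral hJlt s)
    _ = _ := mul_one _

variable {ε N K : ℕ} {U : PowerSeries ℚ} (hU0 : PowerSeries.constantCoeff U = 1) (hUint : IsSlopeInt p (-1) 0 U)
  {a : ℚ} (hid : PowerSeries.rescale (p : ℚ) (laurentSeries A B ε N K) =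
    PowerSeries.C a * laurentSeries A B 0 M J * ((E : ℚ[X]) : PowerSeries ℚ) * U)
include hU0 hUint hid

/-- **THE TWO-SCALE MECHANISM, every depth**: from `rescale_p F_K^{(N)} = C a·F̃_J^{(M)}·E·U` (`U(0) = 1`,
`[T^g]U ∈ p^gℤ_(p)`, `E ∈ ℤ_(p)[X]`, `J ≤ M < p^{L+1}`):
`v(p^{(L+1)d}·[T^d]F_K − a·p^{Ld}·[T^d](F̃_J E)) ≤ v(a)·exp(−(L+1))`. -/
theorem twoScale_depth (d : ℕ) :
    Rat.padicValuation p ((p : ℚ) ^ ((L + 1) * d) * laurent A B ε N K d -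
      a * ((p : ℚ) ^ (L * d) * hatLaurent A B E M J d)) ≤ Rat.padicValuation p a * exp (-((L : ℤ) + 1)) := by
  have hp : p.Prime := Fact.out
  -- coefficientwise form of the identity
  have hsum : ∀ d, (p : ℚ) ^ d * laurent A B ε N K d =
      ∑ x ∈ antidiagonal d, hatLaurent A B E M J x.1 * (a * PowerSeries.coeff x.2 U) := by
    intro d
    have hid' : PowerSeries.rescale (p : ℚ) (laurentSeries A B ε N K) =
        PowerSeries.C a * ((laurentSeries A B 0 M J * ((E : ℚ[X]) : PowerSeries ℚ)) * U) := by rw [hid]; ring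
    have h := congrArg (PowerSeries.coeff d) hid'
    rw [PowerSeries.coeff_rescale, PowerSeries.coeff_C_mul, PowerSeries.coeff_mul, Finset.mul_sum] at h
    rw [laurent, h]
    exact Finset.sum_congr rfl fun x _ => by unfold hatLaurent; ring
  -- `p^{Lg}·a·[T^g]U` pays `v(a)·p^{L+1}` for `g ≥ 1`
  have hW : ∀ g, 1 ≤ g → Rat.padicValuation p ((p : ℚ) ^ (L * g) * (a * PowerSeries.coeff g U)) ≤
      Rat.padicValuation p a * exp (-((L : ℤ) + 1)) := by
    intro g hg
    have hg1 : (1 : ℤ) ≤ g := by exact_mod_cast hg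
    rw [map_mul, map_mul, map_pow, Rat.padicValuation_self, ← exp_nsmul, mul_left_comm]
    refine mul_le_mul' le_rfl ?_
    calc _ ≤ exp ((L * g) • (-1 : ℤ)) * exp (-1 * (g : ℤ) + 0) := mul_le_mul' le_rfl (hUint g)
      _ ≤ _ := by
          rw [← exp_add, exp_le_exp, nsmul_eq_mul]; push_cast
          nlinarith [mul_nonneg (Int.natCast_nonneg L) (sub_nonneg.2 hg1)]
  -- split off the `g = 0` term
  set S : ℚ := ∑ k ∈ range d, hatLaurent A B E M J k * (a * PowerSeries.coeff (d - k) U) with hS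
  have hd : (p : ℚ) ^ d * laurent A B ε N K d = S + hatLaurent A B E M J d * a := by
    rw [hsum d, Finset.Nat.sum_antidiagonal_eq_sum_range_succ
      (fun e g => hatLaurent A B E M J e * (a * PowerSeries.coeff g U)) d, Finset.sum_range_succ, Nat.sub_self,
      PowerSeries.coeff_zero_eq_constantCoeff, hU0, mul_one]
  have hPS : (p : ℚ) ^ (L * d) * S = ∑ k ∈ range d, ((p : ℚ) ^ (L * k) * hatLaurent A B E M J k) *
      ((p : ℚ) ^ (L * (d - k)) * (a * PowerSeries.coeff (d - k) U)) := by
    rw [hS, Finset.mul_sum]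
    refine Finset.sum_congr rfl fun k hk => ?_
    have hk' := mem_range.1 hk
    rw [show L * d = L * k + L * (d - k) by rw [← mul_add]; congr 1; omega, pow_add]
    ring
  rw [show (p : ℚ) ^ ((L + 1) * d) * laurent A B ε N K d = (p : ℚ) ^ (L * d) * ((p : ℚ) ^ d * laurent A B ε N K d) by
      rw [show (L + 1) * d = L * d + d by ring, pow_add, mul_assoc], hd,
    show (p : ℚ) ^ (L * d) * (S + hatLaurent A B E M J d * a) - a * ((p : ℚ) ^ (L * d) * hatLaurent A B E M J d) =
      (p : ℚ) ^ (L * d) * S by ring, hPS]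
  refine Valuation.map_sum_le _ fun k hk => ?_
  have hk' := mem_range.1 hk
  rw [map_mul]
  calc _ ≤ 1 * (Rat.padicValuation p a * exp (-((L : ℤ) + 1))) :=
        mul_le_mul' (level_hatLaurent_integral hp2 hAB hM hJ hE k) (hW (d - k) (by omega))
    _ = _ := one_mul _

/-- **THE TWO-SCALE MECHANISM, harmonic cell**: with `⌊K/p⌋ = J`:
`v(p^{(L+1)A}·cell^{(0)}_K(N) − a·hatLaurentZero) ≤ v(a)·exp(−(L+1))` ((B2′): `p^{(L+1)s}H_K^{(s)} ≡ p^{Ls}H_J^{(s)}`). -/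
theorem twoScale_zero (hKJ : K / p = J) :
    Rat.padicValuation p ((p : ℚ) ^ ((L + 1) * A) * cellZero A B ε N K -
      a * hatLaurentZero A B E p L M J) ≤ Rat.padicValuation p a * exp (-((L : ℤ) + 1)) := by
  have hp : p.Prime := Fact.out
  have hJlt : J < p ^ (L + 1) := lt_of_le_of_lt hJ hM
  have hx : (p : ℚ) ^ ((L + 1) * A) * cellZero A B ε N K =
      -∑ s ∈ Icc 1 A, ((p : ℚ) ^ ((L + 1) * (A - s)) * cell A B ε N K s) * ((p : ℚ) ^ ((L + 1) * s) * hsum s K) := by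
    rw [cellZero_eq, mul_neg, Finset.mul_sum]
    congr 1
    refine Finset.sum_congr rfl fun s hs => ?_
    have hs' := mem_Icc.1 hs
    rw [show (p : ℚ) ^ ((L + 1) * A) = (p : ℚ) ^ ((L + 1) * (A - s)) * (p : ℚ) ^ ((L + 1) * s) by
      rw [← pow_add, ← mul_add, Nat.sub_add_cancel hs'.2]]
    ring
  have hy : a * hatLaurentZero A B E p L M J =
      -∑ s ∈ Icc 1 A, (a * ((p : ℚ) ^ (L * (A - s)) * hatLaurent A B E M J (A - s))) * ((p : ℚ) ^ (L * s) * hsum s J) := by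
    rw [hatLaurentZero, mul_neg, Finset.mul_sum]
    congr 1
    exact Finset.sum_congr rfl fun s _ => by ring
  rw [hx, hy, neg_sub_neg, ← Finset.sum_sub_distrib]
  refine Valuation.map_sum_le _ fun s hs => ?_
  have hs' := mem_Icc.1 hs
  rw [Valuation.map_sub_swap]
  -- the two congruences and the two integrality bounds
  have h₁ := twoScale_depth hp2 hAB hM hJ hE hU0 hUint hid (A - s)
  rw [show cell A B ε N K s = laurent A B ε N K (A - s) from rfl]
  have h₂ := level_hsum_sub_le (p := p) hs'.1 L K
  rw [hKJ] at h₂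
  have hy₁ : Rat.padicValuation p (a * ((p : ℚ) ^ (L * (A - s)) * hatLaurent A B E M J (A - s))) ≤
      Rat.padicValuation p a := by
    rw [map_mul]
    calc _ ≤ Rat.padicValuation p a * 1 := mul_le_mul' le_rfl (level_hatLaurent_integral hp2 hAB hM hJ hE _)
      _ = _ := mul_one _
  have hx₁ : Rat.padicValuation p ((p : ℚ) ^ ((L + 1) * (A - s)) * laurent A B ε N K (A - s)) ≤
      Rat.padicValuation p a := by
    have h := Valuation.map_add (Rat.padicValuation p)
      ((p : ℚ) ^ ((L + 1) * (A - s)) * laurent A B ε N K (A - s) -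
        a * ((p : ℚ) ^ (L * (A - s)) * hatLaurent A B E M J (A - s)))
      (a * ((p : ℚ) ^ (L * (A - s)) * hatLaurent A B E M J (A - s)))
    rw [sub_add_cancel] at h
    refine h.trans (max_le (h₁.trans ?_) hy₁)
    calc _ ≤ Rat.padicValuation p a * 1 := mul_le_mul' le_rfl (by rw [← exp_zero, exp_le_exp]; omega)
      _ = _ := mul_one _
  have hy₂ := level_hsum_integral (p := p) hJlt s
  rw [show (p : ℚ) ^ ((L + 1) * (A - s)) * laurent A B ε N K (A - s) * ((p : ℚ) ^ ((L + 1) * s) * hsum s K) -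
      a * ((p : ℚ) ^ (L * (A - s)) * hatLaurent A B E M J (A - s)) * ((p : ℚ) ^ (L * s) * hsum s J) =
    (p : ℚ) ^ ((L + 1) * (A - s)) * laurent A B ε N K (A - s) *
        ((p : ℚ) ^ ((L + 1) * s) * hsum s K - (p : ℚ) ^ (L * s) * hsum s J) +
      ((p : ℚ) ^ ((L + 1) * (A - s)) * laurent A B ε N K (A - s) -
        a * ((p : ℚ) ^ (L * (A - s)) * hatLaurent A B E M J (A - s))) * ((p : ℚ) ^ (L * s) * hsum s J) by ring]
  refine Valuation.map_add_le _ ?_ ?_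
  · rw [map_mul]; exact mul_le_mul' hx₁ h₂
  · rw [map_mul]
    calc _ ≤ Rat.padicValuation p a * exp (-((L : ℤ) + 1)) * 1 := mul_le_mul' h₁ hy₂
      _ = _ := mul_one _

end generic

/-! ## The hat cells of an off-digit block -/

section hat

variable (hp2 : p ≠ 2) {A B : ℕ} (hA : Even A) (hAB : 2 * B ≤ A) {m j L : ℕ} (hm : m < p ^ (L + 1)) (hj : j ≤ m)
include hp2 hA hAB hj

/-- `v(hatMult) = exp(−A)·v(n)^{A−2B} ≤ exp(−A)` (`Λ°` is a unit). -/
theorem padicValuation_hatMult_le {i : ℕ} (hi1 : 1 ≤ i) (hip : i < p) :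
    Rat.padicValuation p (hatMult A B p m j i) ≤ exp (-(A : ℤ)) := by
  obtain ⟨M, rfl⟩ := Nat.exists_eq_add_of_le hj
  rw [hatMult_eq, map_mul, padicValuation_hatLam hp2 hA hAB (i' := p - i) (by omega) hi1 (by omega), one_mul, map_mul,
    map_pow, map_pow, Rat.padicValuation_self, ← exp_nsmul, nsmul_eq_mul, mul_neg_one]
  calc _ ≤ exp (-(A : ℤ)) * 1 := mul_le_mul' le_rfl (pow_le_one' (padicValuation_natCast_le_one _) _)
    _ = _ := mul_one _

omit hp2 hA hAB hj in
/-- `Σ_{i=1}^{p−1} hatMult_{jp+i} = p^A·n^{A−2B}·Ŵ(j)`. -/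
theorem sum_hatMult_eq : ∑ t ∈ range (p - 1), hatMult A B p m j (t + 1) =
    (p : ℚ) ^ A * (((m + 1 : ℕ) : ℚ)) ^ (A - 2 * B) * hatW A B p m j := by
  unfold hatW
  rw [Finset.mul_sum]
  exact Finset.sum_congr rfl fun t _ => by rw [hatMult_eq]; ring

/-- `v(p^A·n^{A−2B}·Ŵ(j)) ≤ exp(−(A+1))`. -/
theorem padicValuation_blockConst_le :
    Rat.padicValuation p ((p : ℚ) ^ A * (((m + 1 : ℕ) : ℚ)) ^ (A - 2 * B) * hatW A B p m j) ≤ exp (-((A : ℤ) + 1)) := by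
  rw [map_mul, map_mul, map_pow, map_pow, Rat.padicValuation_self, ← exp_nsmul, nsmul_eq_mul, mul_neg_one]
  calc _ ≤ exp (-(A : ℤ)) * 1 * exp (-1 : ℤ) :=
        mul_le_mul' (mul_le_mul' le_rfl (pow_le_one' (padicValuation_natCast_le_one _) _)) (hatW_le hp2 hA hAB hj)
    _ = _ := by rw [mul_one, ← exp_add]; congr 1; ring

include hm

/-- **(4.1) at every depth**: for the off-digit cell `K = i + jp` of the row `np` (`n = m+1`, `m < p^{L+1}`):
`v(p^{(L+1)d}[T^d]F_K^{(np)} − hatMult·p^{Ld}[T^d](F̃_j Ê_j)) ≤ exp(−(A+L+1))`. -/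
theorem hat_cell_depth {i : ℕ} (hi1 : 1 ≤ i) (hip : i < p) (d : ℕ) :
    Rat.padicValuation p ((p : ℚ) ^ ((L + 1) * d) * laurent A B 1 ((m + 1) * p) (i + j * p) d -
      hatMult A B p m j i * ((p : ℚ) ^ (L * d) * hatLaurent A B (hatPoly B m j) m j d)) ≤ exp (-((A : ℤ) + L + 1)) := by
  obtain ⟨U, hU0, hUint, a, hid, ha⟩ := laurentSeries_rescale_eq_hat (p := p) hp2 (A := A) (B := B) hi1 hip hj
  have hK : i + j * p ≤ (m + 1) * p := by nlinarith
  rw [eq_hatMult hAB hj hK ha] at hid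
  refine (twoScale_depth hp2 hAB hm hj (padicValuation_hatPoly_coeff_le B m j) hU0 hUint hid d).trans ?_
  calc _ ≤ exp (-(A : ℤ)) * exp (-((L : ℤ) + 1)) := mul_le_mul' (padicValuation_hatMult_le hp2 hA hAB hj hi1 hip) le_rfl
    _ = _ := by rw [← exp_add]; congr 1; ring

/-- **(4.1), harmonic cell**: `v(p^{(L+1)A}cell^{(0)}_K(np) − hatMult·hatLaurentZero) ≤ exp(−(A+L+1))`. -/
theorem hat_cell_zero {i : ℕ} (hi1 : 1 ≤ i) (hip : i < p) :
    Rat.padicValuation p ((p : ℚ) ^ ((L + 1) * A) * cellZero A B 1 ((m + 1) * p) (i + j * p) -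
      hatMult A B p m j i * hatLaurentZero A B (hatPoly B m j) p L m j) ≤ exp (-((A : ℤ) + L + 1)) := by
  have hp : p.Prime := Fact.out
  obtain ⟨U, hU0, hUint, a, hid, ha⟩ := laurentSeries_rescale_eq_hat (p := p) hp2 (A := A) (B := B) hi1 hip hj
  have hK : i + j * p ≤ (m + 1) * p := by nlinarith
  rw [eq_hatMult hAB hj hK ha] at hid
  have hKJ : (i + j * p) / p = j := by rw [Nat.add_mul_div_right _ _ hp.pos, Nat.div_eq_of_lt hip, zero_add]
  refine (twoScale_zero hp2 hAB hm hj (padicValuation_hatPoly_coeff_le B m j) hU0 hUint hid hKJ).trans ?_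
  calc _ ≤ exp (-(A : ℤ)) * exp (-((L : ℤ) + 1)) := mul_le_mul' (padicValuation_hatMult_le hp2 hA hAB hj hi1 hip) le_rfl
    _ = _ := by rw [← exp_add]; congr 1; ring

/-- **LEMMA 9.4 blockwise, every depth**: the `p − 1` off-digit cells of block `j` against the MAIN hat term,
`v(Σ_{i=1}^{p−1} p^{(L+1)d}[T^d]F_{jp+i}^{(np)} − p^{A+1}·g₀(j)·p^{Ld}[T^d]F̃_j^{(m)}) ≤ exp(−(A+L+1))`
(`p^{A+1}g₀(j) = p^A n^{A−2B}Ŵ(j)Ê_j(0)`; the non-constant part of `Ê_j` costs `p^L` more, paid by `Ŵ ≡ 0 (mod p)`). -/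
theorem hat_block_main (d : ℕ) :
    Rat.padicValuation p (∑ t ∈ range (p - 1), (p : ℚ) ^ ((L + 1) * d) * laurent A B 1 ((m + 1) * p) (t + 1 + j * p) d -
      (p : ℚ) ^ (A + 1) * hatG A B p m j * ((p : ℚ) ^ (L * d) * laurent A B 0 m j d)) ≤ exp (-((A : ℤ) + L + 1)) := by
  have hp : p.Prime := Fact.out
  have hpQ : (p : ℚ) ≠ 0 := by exact_mod_cast hp.ne_zero
  set c : ℚ := (p : ℚ) ^ A * (((m + 1 : ℕ) : ℚ)) ^ (A - 2 * B) * hatW A B p m j with hc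
  have hG : (p : ℚ) ^ (A + 1) * hatG A B p m j = c * (hatPoly B m j).eval 0 := by
    rw [hatG, hc, pow_succ]; field_simp
  rw [hG, show ∑ t ∈ range (p - 1), (p : ℚ) ^ ((L + 1) * d) * laurent A B 1 ((m + 1) * p) (t + 1 + j * p) d -
      c * (hatPoly B m j).eval 0 * ((p : ℚ) ^ (L * d) * laurent A B 0 m j d) =
    (∑ t ∈ range (p - 1), (p : ℚ) ^ ((L + 1) * d) * laurent A B 1 ((m + 1) * p) (t + 1 + j * p) d -
      c * ((p : ℚ) ^ (L * d) * hatLaurent A B (hatPoly B m j) m j d)) +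
    c * ((p : ℚ) ^ (L * d) * hatLaurent A B (hatPoly B m j) m j d -
      (hatPoly B m j).eval 0 * ((p : ℚ) ^ (L * d) * laurent A B 0 m j d)) by ring]
  refine (Valuation.map_add _ _ _).trans (max_le ?_ ?_)
  · rw [hc, ← sum_hatMult_eq (p := p) (A := A) (B := B) (m := m) (j := j), Finset.sum_mul, ← Finset.sum_sub_distrib]
    refine Valuation.map_sum_le _ fun t ht => ?_
    have ht' := mem_range.1 ht
    exact hat_cell_depth hp2 hA hAB hm hj (by omega) (by omega) d
  · rw [map_mul]
    calc _ ≤ exp (-((A : ℤ) + 1)) * exp (-(L : ℤ)) := mul_le_mul' (padicValuation_blockConst_le hp2 hA hAB hj)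
          (hatLaurent_main_sub_le hp2 hAB hm hj (padicValuation_hatPoly_coeff_le B m j) d)
      _ = _ := by rw [← exp_add]; congr 1; ring

/-- **LEMMA 9.4 blockwise, harmonic cell**:
`v(Σ_{i=1}^{p−1} p^{(L+1)A}cell^{(0)}_{jp+i}(np) − p^{A+1}·g₀(j)·p^{LA}cell̃^{(0)}_j(m)) ≤ exp(−(A+L+1))`. -/
theorem hat_block_main_zero :
    Rat.padicValuation p (∑ t ∈ range (p - 1), (p : ℚ) ^ ((L + 1) * A) * cellZero A B 1 ((m + 1) * p) (t + 1 + j * p) -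
      (p : ℚ) ^ (A + 1) * hatG A B p m j * ((p : ℚ) ^ (L * A) * cellZero A B 0 m j)) ≤ exp (-((A : ℤ) + L + 1)) := by
  have hp : p.Prime := Fact.out
  have hpQ : (p : ℚ) ≠ 0 := by exact_mod_cast hp.ne_zero
  set c : ℚ := (p : ℚ) ^ A * (((m + 1 : ℕ) : ℚ)) ^ (A - 2 * B) * hatW A B p m j with hc
  have hG : (p : ℚ) ^ (A + 1) * hatG A B p m j = c * (hatPoly B m j).eval 0 := by
    rw [hatG, hc, pow_succ]; field_simp
  rw [hG, show ∑ t ∈ range (p - 1), (p : ℚ) ^ ((L + 1) * A) * cellZero A B 1 ((m + 1) * p) (t + 1 + j * p) -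
      c * (hatPoly B m j).eval 0 * ((p : ℚ) ^ (L * A) * cellZero A B 0 m j) =
    (∑ t ∈ range (p - 1), (p : ℚ) ^ ((L + 1) * A) * cellZero A B 1 ((m + 1) * p) (t + 1 + j * p) -
      c * hatLaurentZero A B (hatPoly B m j) p L m j) +
    c * (hatLaurentZero A B (hatPoly B m j) p L m j -
      (hatPoly B m j).eval 0 * ((p : ℚ) ^ (L * A) * cellZero A B 0 m j)) by ring]
  refine (Valuation.map_add _ _ _).trans (max_le ?_ ?_)
  · rw [hc, ← sum_hatMult_eq (p := p) (A := A) (B := B) (m := m) (j := j), Finset.sum_mul, ← Finset.sum_sub_distrib]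
    refine Valuation.map_sum_le _ fun t ht => ?_
    have ht' := mem_range.1 ht
    exact hat_cell_zero hp2 hA hAB hm hj (by omega) (by omega)
  · rw [map_mul]
    calc _ ≤ exp (-((A : ℤ) + 1)) * exp (-(L : ℤ)) := mul_le_mul' (padicValuation_blockConst_le hp2 hA hAB hj)
          (hatLaurentZero_main_sub_le hp2 hAB hm hj (padicValuation_hatPoly_coeff_le B m j))
      _ = _ := by rw [← exp_add]; congr 1; ring

end hat

end

end Summit.KontsevichZagierPeriods.Zeta5Search.BrickHatReduction
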